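import Summits.NavierStokesRegularity.NavierStokesRegularity.Theorems.HubbleDynamoNoSelfExcitedDynamoStubRecurrentProfile
import Literature.Dynamics.TopologicalDynamics.UniformRecurrence
import HarnessLib

/-!
# Crux `NoSelfExcitedDynamo` (stmt-NavierStokesRegularity-1934), line `registered`: a past amplitude
  floor is realised by a UNIFORMLY RECURRENT eternal profile-class solution

Theorems file (lands `--supports stmt-NavierStokesRegularity-1934`; registered sub-goal
`stub_uniformlyRecurrentProfile`). Let `(U, P)` be an ETERNAL classical solution of Leray's backward
system `∂ₛU + ½U + ½(y·∇)U + (U·∇)U + ∇P = ΔU`, `div U = 0` on `ℝ × ℝ³`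
(`IsBackwardLeraySolutionOn univ 1 U P`) in the uniform profile class
`(1 + ‖y‖)^{k+1}‖DᵏU(s, y)‖ ≤ K_k`, keeping an amplitude floor `δ > 0` on a past half-line
(`∀ s ≤ S, ∃ y, δ ≤ ‖U(s, y)‖`). Then some eternal profile-class solution `(W, Q)` keeps the floor
`δ` at EVERY similarity time and is moreover UNIFORMLY RECURRENT under REAL similarity-time shifts,
uniformly on compacts: for every `ε > 0` and radius `R` there is `L > 0` such that EVERY window
`[a, a + L]` contains a shift `σ` with `‖W(s + σ, y) − W(s, y)‖ < ε` on `[−R, R] × B̄(0, R)`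
(`stub_uniformlyRecurrentProfile`); in particular the return shifts are relatively dense in both
time directions. This upgrades the sibling `stub_recurrentProfile` (recurrence along SOME integers
`n ≥ N`) from Birkhoff recurrence of the unit shift to Birkhoff–Furstenberg uniform recurrence of
the real shift flow.

Proof (uniform recurrence in a compact shift-invariant set of fields).
1. `stub_alphaLimit` (KNSS 2009, Lemma 6.1) gives an eternal profile-class `(W₀, Q₀)` with the floor
   at every time; let `K₀` be its `k = 0` profile constant, `(1 + ‖y‖)‖W₀(s, y)‖ ≤ K₀`.
2. In `X = C(ℝ × ℝ³, ℝ³)` with the compact-open topology consider, exactly as in the sibling file,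
   the set `K` of uncurried eternal profile-class solutions with `k = 0` constant `K₀` and floor `δ`
   at every time: it contains `W₀` and is compact (`recurrentProfile_isSeqCompact`, via the sibling
   stub `stub_limitClosed`, and `IsSeqCompact.isCompact`).
3. The real shifts `(ϕ σ F)(s, y) = F(s + σ, y)` act on `X` by continuous maps (precomposition,
   `ContinuousMap.continuous_precomp`) with the action law `ϕ (σ₁ + σ₂) = ϕ σ₁ ∘ ϕ σ₂`, and map `K`
   into itself (Leray's system is autonomous, `alphaLimit_translate`; the bound, the profile class
   and the floor are reindexed: `uniformlyRecurrentProfile_mapsTo_shift`).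
4. Birkhoff–Furstenberg (`Literature.Dynamics.TopologicalDynamics.exists_isUniformlyRecurrentPt`,
   Furstenberg 1981, Thm. 1.16): a nonempty compact invariant set of such an action carries a
   UNIFORMLY recurrent point `F`, i.e. the return times of `F` to each of its neighbourhoods form a
   syndetic set of reals, which means relatively dense
   (`Literature.Dynamics.TopologicalDynamics.isSyndetic_iff_exists_window`).
5. Applied to the basic compact-convergence neighbourhoods `recurrentProfile_box_mem_nhds` of `F`
   this is the stated estimate.

## References

* H. Furstenberg, *Recurrence in Ergodic Theory and Combinatorial Number Theory*, Princeton UP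
  (1981), Ch. 1 §4: Def. 1.7 (syndetic), Def. 1.8 (uniformly recurrent), Thm. 1.16 (a compact
  system has a uniformly recurrent point).
* G. D. Birkhoff, *Dynamical systems*, AMS Colloquium Publ. IX (1927), Ch. VII §1–2.
* G. Koch, N. Nadirashvili, G. Seregin, V. Šverák, *Liouville theorems for the Navier–Stokes
  equations and applications*, Acta Math. 203 (2009) 83–105 = arXiv:0709.3599, Lemma 6.1.
  [KochNadirashviliSereginSverak2009]
-/

noncomputable section

-- the mandated stub namespace repeats `NavierStokesRegularity` (tree precedent for this crux's stubs)
set_option linter.dupNamespace false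

namespace Summit.NavierStokesRegularity.NavierStokesRegularity.Theorems.NoSelfExcitedDynamo.Registered

open Set MeasureTheory Filter Topology Function Metric
open scoped ContDiff
open Literature.Analysis
open Literature.Analysis.FluidPDE
open Literature.Dynamics.TopologicalDynamics

/-! ### The recurrence set is invariant under every real shift -/

/-- **The recurrence set is invariant under every real shift.** Let `K ⊆ C(ℝ × ℝ³, ℝ³)` be the set
of uncurried eternal classical solutions `W` of Leray's backward system in the uniform profile
class with `k = 0` constant `(1 + ‖y‖)‖W(s, y)‖ ≤ K₀` and the amplitude floor `δ` at every
similarity time, and let `T` be any self-map of `C(ℝ × ℝ³, ℝ³)` acting as the shift by `σ` in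
similarity time, `(T G)(s, y) = G(s + σ, y)`. Then `T(K) ⊆ K`: Leray's system is autonomous in `s`
(`alphaLimit_translate`), and the bound, the profile class and the floor are reindexed (the
real-shift version of `recurrentProfile_mapsTo_shift`). -/
theorem uniformlyRecurrentProfile_mapsTo_shift {K₀ δ : ℝ}
    {K : Set C(ℝ × EuclideanSpace ℝ (Fin 3), EuclideanSpace ℝ (Fin 3))}
    (hK : ∀ F, F ∈ K ↔ ∃ (W : ℝ → EuclideanSpace ℝ (Fin 3) → EuclideanSpace ℝ (Fin 3))
      (Q : ℝ → EuclideanSpace ℝ (Fin 3) → ℝ), IsBackwardLeraySolutionOn univ 1 W Q ∧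
      (∀ s y, (1 + ‖y‖) * ‖W s y‖ ≤ K₀) ∧
      (∀ k : ℕ, ∃ K : ℝ, ∀ s y, (1 + ‖y‖) ^ (k + 1) * ‖iteratedFDeriv ℝ k (W s) y‖ ≤ K) ∧
      (∀ s, ∃ y, δ ≤ ‖W s y‖) ∧ ∀ s y, F (s, y) = W s y)
    (σ : ℝ)
    (T : C(ℝ × EuclideanSpace ℝ (Fin 3), EuclideanSpace ℝ (Fin 3)) →
      C(ℝ × EuclideanSpace ℝ (Fin 3), EuclideanSpace ℝ (Fin 3)))
    (hT : ∀ (G : C(ℝ × EuclideanSpace ℝ (Fin 3), EuclideanSpace ℝ (Fin 3))) (s : ℝ)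
      (y : EuclideanSpace ℝ (Fin 3)), T G (s, y) = G (s + σ, y)) :
    MapsTo T K K := by
  intro F hF
  obtain ⟨W, Q, hW, hbd, hprof, hfl, hFW⟩ := (hK F).1 hF
  refine (hK _).2 ⟨fun s => W (s + σ), fun s => Q (s + σ), alphaLimit_translate hW σ,
    fun s y => hbd _ y, fun k => ?_, fun s => hfl _, fun s y => ?_⟩
  · obtain ⟨K', hK'⟩ := hprof k
    exact ⟨K', fun s y => hK' _ y⟩
  · rw [hT]
    exact hFW _ y

/-! ### The registered stub -/

/-- **Stub `stub_uniformlyRecurrentProfile`** (Birkhoff–Furstenberg uniform recurrence for eternal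
profile flows). If an eternal profile-class solution `(U, P)` of Leray's backward system keeps an
amplitude floor `δ > 0` on a past half-line, then some eternal profile-class `(W, Q)` keeps the
floor at every similarity time AND is UNIFORMLY RECURRENT under real similarity-time shifts,
uniformly on compacts: for every `ε > 0` and `R` there is `L > 0` such that every window
`[a, a + L]` contains `σ` with `‖W(s + σ, y) − W(s, y)‖ < ε` on `[−R, R] × B̄(0, R)`. Proof:
`stub_alphaLimit` realises the floor at every time by some `W₀` with `k = 0` constant `K₀`; the set
of uncurried eternal profile-class fields with constant `K₀` and floor `δ` is a nonempty compact
(`recurrentProfile_isSeqCompact`) subset of `C(ℝ × ℝ³, ℝ³)` invariant under every real time shift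
(`uniformlyRecurrentProfile_mapsTo_shift`); the shifts act by continuous maps
(`ContinuousMap.continuous_precomp`) with the action law, so the set carries a uniformly recurrent
point (`exists_isUniformlyRecurrentPt`, Furstenberg 1981, Thm. 1.16), whose return-time sets to the
compact-convergence neighbourhoods `recurrentProfile_box_mem_nhds` are syndetic, i.e. relatively
dense (`isSyndetic_iff_exists_window`). -/
theorem stub_uniformlyRecurrentProfile :
    ∀ (U : ℝ → EuclideanSpace ℝ (Fin 3) → EuclideanSpace ℝ (Fin 3)) (P : ℝ → EuclideanSpace ℝ (Fin 3) → ℝ),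
      IsBackwardLeraySolutionOn univ 1 U P →
      (∀ k : ℕ, ∃ K : ℝ, ∀ s y, (1 + ‖y‖) ^ (k + 1) * ‖iteratedFDeriv ℝ k (U s) y‖ ≤ K) →
      ∀ (δ S : ℝ), 0 < δ → (∀ s ≤ S, ∃ y, δ ≤ ‖U s y‖) →
        ∃ (W : ℝ → EuclideanSpace ℝ (Fin 3) → EuclideanSpace ℝ (Fin 3)) (Q : ℝ → EuclideanSpace ℝ (Fin 3) → ℝ),
          IsBackwardLeraySolutionOn univ 1 W Q ∧
          (∀ k : ℕ, ∃ K : ℝ, ∀ s y, (1 + ‖y‖) ^ (k + 1) * ‖iteratedFDeriv ℝ k (W s) y‖ ≤ K) ∧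
          (∀ s, ∃ y, δ ≤ ‖W s y‖) ∧
          ∀ ε : ℝ, 0 < ε → ∀ R : ℝ, ∃ L : ℝ, 0 < L ∧ ∀ a : ℝ, ∃ σ ∈ Icc a (a + L),
            ∀ s ∈ Icc (-R) R, ∀ y ∈ Metric.closedBall (0 : EuclideanSpace ℝ (Fin 3)) R,
              ‖W (s + σ) y - W s y‖ < ε := by
  intro U P hL hprof δ S hδ hfloor
  -- an eternal profile-class solution with the floor at every time, and its `k = 0` constant
  obtain ⟨W₀, Q₀, hW₀, hW₀prof, hW₀fl⟩ := stub_alphaLimit U P hL hprof δ S hfloor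
  obtain ⟨K₀, hK₀'⟩ := hW₀prof 0
  have hK₀ : ∀ s y, (1 + ‖y‖) * ‖W₀ s y‖ ≤ K₀ := fun s y => by
    have h := hK₀' s y
    rwa [zero_add, pow_one, norm_iteratedFDeriv_zero] at h
  -- the recurrence set `K ⊆ C(ℝ × ℝ³, ℝ³)`
  set K : Set C(ℝ × EuclideanSpace ℝ (Fin 3), EuclideanSpace ℝ (Fin 3)) :=
    {F | ∃ (W : ℝ → EuclideanSpace ℝ (Fin 3) → EuclideanSpace ℝ (Fin 3))
      (Q : ℝ → EuclideanSpace ℝ (Fin 3) → ℝ), IsBackwardLeraySolutionOn univ 1 W Q ∧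
      (∀ s y, (1 + ‖y‖) * ‖W s y‖ ≤ K₀) ∧
      (∀ k : ℕ, ∃ K : ℝ, ∀ s y, (1 + ‖y‖) ^ (k + 1) * ‖iteratedFDeriv ℝ k (W s) y‖ ≤ K) ∧
      (∀ s, ∃ y, δ ≤ ‖W s y‖) ∧ ∀ s y, F (s, y) = W s y}
  have hK : ∀ F, F ∈ K ↔ ∃ (W : ℝ → EuclideanSpace ℝ (Fin 3) → EuclideanSpace ℝ (Fin 3))
      (Q : ℝ → EuclideanSpace ℝ (Fin 3) → ℝ), IsBackwardLeraySolutionOn univ 1 W Q ∧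
      (∀ s y, (1 + ‖y‖) * ‖W s y‖ ≤ K₀) ∧
      (∀ k : ℕ, ∃ K : ℝ, ∀ s y, (1 + ‖y‖) ^ (k + 1) * ‖iteratedFDeriv ℝ k (W s) y‖ ≤ K) ∧
      (∀ s, ∃ y, δ ≤ ‖W s y‖) ∧ ∀ s y, F (s, y) = W s y := fun F => Iff.rfl
  -- the real shifts of similarity time `τ σ (s, y) = (s + σ, y)` and their action `ϕ σ G = G ∘ τ σ`
  obtain ⟨τ, hτ⟩ : ∃ τ : ℝ → C(ℝ × EuclideanSpace ℝ (Fin 3), ℝ × EuclideanSpace ℝ (Fin 3)),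
      ∀ (σ s : ℝ) (y : EuclideanSpace ℝ (Fin 3)), τ σ (s, y) = (s + σ, y) :=
    ⟨fun σ => ⟨fun z => (z.1 + σ, z.2), (continuous_fst.add continuous_const).prodMk continuous_snd⟩,
      fun _ _ _ => rfl⟩
  obtain ⟨ϕ, hϕ, hcont⟩ : ∃ ϕ : ℝ → C(ℝ × EuclideanSpace ℝ (Fin 3), EuclideanSpace ℝ (Fin 3)) →
      C(ℝ × EuclideanSpace ℝ (Fin 3), EuclideanSpace ℝ (Fin 3)),
      (∀ (σ : ℝ) (G : C(ℝ × EuclideanSpace ℝ (Fin 3), EuclideanSpace ℝ (Fin 3))) (s : ℝ)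
        (y : EuclideanSpace ℝ (Fin 3)), ϕ σ G (s, y) = G (s + σ, y)) ∧ ∀ σ, Continuous (ϕ σ) :=
    ⟨fun σ G => G.comp (τ σ), fun σ G s y => by rw [ContinuousMap.comp_apply, hτ],
      fun σ => ContinuousMap.continuous_precomp (τ σ)⟩
  -- the action law `ϕ (σ₁ + σ₂) = ϕ σ₁ ∘ ϕ σ₂` and the invariance of `K`
  have hadd : ∀ (σ₁ σ₂ : ℝ) (G : C(ℝ × EuclideanSpace ℝ (Fin 3), EuclideanSpace ℝ (Fin 3))),
      ϕ (σ₁ + σ₂) G = ϕ σ₁ (ϕ σ₂ G) := fun σ₁ σ₂ G => by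
    refine ContinuousMap.ext fun z => ?_
    obtain ⟨s, y⟩ := z
    rw [hϕ, hϕ, hϕ, add_assoc]
  have hinv : ∀ σ : ℝ, MapsTo (ϕ σ) K K := fun σ =>
    uniformlyRecurrentProfile_mapsTo_shift hK σ (ϕ σ) (hϕ σ)
  -- Birkhoff–Furstenberg uniform recurrence in the nonempty compact invariant set `K`
  have hne : K.Nonempty :=
    ⟨⟨uncurry W₀, recurrentProfile_continuous_uncurry hW₀⟩,
      (hK _).2 ⟨W₀, Q₀, hW₀, hK₀, hW₀prof, hW₀fl, fun _ _ => rfl⟩⟩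
  have hKc : IsCompact K := (recurrentProfile_isSeqCompact hK hδ).isCompact
  obtain ⟨F, hF, hrec⟩ := exists_isUniformlyRecurrentPt (G := ℝ) hcont hadd hKc hne hinv
  obtain ⟨W, Q, hW, -, hWprof, hWfl, hFW⟩ := (hK F).1 hF
  refine ⟨W, Q, hW, hWprof, hWfl, fun ε hε R => ?_⟩
  -- the return times to the box neighbourhood are syndetic, i.e. relatively dense
  obtain ⟨L, hLpos, hret⟩ :=
    isSyndetic_iff_exists_window.1 (hrec _ (recurrentProfile_box_mem_nhds F hε R))
  refine ⟨L, hLpos, fun a => ?_⟩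
  obtain ⟨σ, hσ, hσret⟩ := hret a
  refine ⟨σ, hσ, fun s hs y hy => ?_⟩
  have h : dist (F (s, y)) (ϕ σ F (s, y)) < ε := hσret (s, y) ⟨hs, hy⟩
  rw [hϕ, hFW, hFW, dist_comm, dist_eq_norm] at h
  exact h

end Summit.NavierStokesRegularity.NavierStokesRegularity.Theorems.NoSelfExcitedDynamo.Registered

end
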